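import Literature.Computability.QuantumComplexity.CliffordTSymbolicPaths
import HarnessLib

/-!
# Bravyi–Gosset pairing of `T` gates and the Gauss-sum data of one Monte-Carlo term

Topic `Literature/Computability/QuantumComplexity`, sub-namespace `BravyiGosset`, third file
towards `BravyiGosset2016_estimateAcceptProb_holds` (after `CliffordGaussSums.lean`,
`CliffordTSymbolicPaths.lean`).

After symbolic execution (`SymState.exec`) the amplitude `√2^h ⟨z|U|y⟩` of a Clifford+`T` circuit
is `Σ_w [label(w) = z] · i^{μ+Λw} (−1)^{B(w)} · ω^{#{k : u_k(w) = 1}}`, `u_k` the affine forms seen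
by the `t` `T`-gates. Bravyi–Gosset's decomposition of a **pair** of magic states into two
stabilizer states (2016, eq. (17): `|A⟩^{⊗2} = ½(|00⟩ + i|11⟩) + (ω/√2)·(|01⟩ + |10⟩)/√2`, i.e.
`χ(|A⟩^{⊗2}) = 2`, whence `χ_t ≤ 2^{⌈t/2⌉}`) reads, on the phases of two `T` gates,
```
  ω^{u + u'} = [u = u'] · i^{u} + ω · [u ≠ u'],        u, u' ∈ {0, 1},
```
(`omega_pow_pair`), so that `ω^{Σ_k u_k(w)} = Σ_{a ∈ 𝔽₂^{⌈t/2⌉}} ω^{|a|} Π_p χ_p(a_p, w)` with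
`χ_p(0, w) = [u_{2p} = u_{2p+1}] i^{u_{2p}}`, `χ_p(1, w) = [u_{2p} ≠ u_{2p+1}]` (an odd `t` is the
pair with `u_{t} ≡ 0`). Every constraint `[f(w) = 0]` is `½ Σ_s (−1)^{s f(w)}`, one fresh
variable `s`. Hence, for each `a` and each "equatorial" test state
`θ_β(z) = 2^{-N/2} (−1)^{z·R z} i^{ρ·z}` (read off a bit string `β`: `R` strictly upper triangular,
`ρ ∈ ℤ₄^N`; Bravyi–Browne–Calpin–Campbell–Gosset–Howard 2019, §4.1 use such states for norm
estimation), the quantity `Σ_{z : z₀ = 1} θ̄_β(z) √2^h ⟨z|U|y⟩` restricted to the `a`-th term is ONE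
exponential sum `Γ(a, β)` of the kind evaluated by `GData.gaussEval`:

* `augTheta`, `augOut`, `augA`, `buildData` — the data of `Γ(a, β)` over `V = h + 1 + ⌈t/2⌉`
  variables, with value theorems `val_augTheta`, `val_augOut`, `val_augA`;
* `ccPhase N β z = (−1)^{z·Rz} i^{−ρ·z}` — the conjugate test phase;
* **`sum_omega_pow_mul_gsum_buildData`** (the key identity):
  `Σ_a ω^{|a|} Γ(a, β) = 2^{1+⌈t/2⌉} Σ_{v ∈ 𝔽₂^h} [label₀(v) = 1] θ̄-phase(label(v)) · phase(v)`,
  which by `prodZeta_apply_eq_sum` is `2^{1+⌈t/2⌉} Σ_{z, z₀=1} ccPhase(z) √2^h ⟨z|U|y⟩`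
  (`sum_omega_pow_mul_gsum_buildData_eq_amplitudes`).

## References

* S. Bravyi, D. Gosset, *Improved classical simulation of quantum circuits dominated by Clifford
  gates*, Phys. Rev. Lett. 116 (2016) 250501, arXiv:1601.07601v3: §II (gadgetization,
  `P_out = 2^{-u} ⟨A^{⊗t}|Π_G|A^{⊗t}⟩`, eq. (12)–(13) `ψ = Σ_a z_a φ_a` with `χ` terms), eq. (17)
  (the two-term decomposition of `|A⟩^{⊗2}`, `χ₂ = 2`).
* S. Bravyi, D. Browne, P. Calpin, E. Campbell, D. Gosset, M. Howard, *Simulation of quantum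
  circuits by low-rank stabilizer decompositions*, Quantum 3 (2019) 181, §4.1 (norm estimation
  with random equatorial states `2^{-n/2} Σ_x i^{x^T A x} |x⟩`).
-/

noncomputable section

namespace Literature.Computability.QuantumComplexity.BravyiGosset

open Complex Finset _root_.Computability Literature.Computability.Complexity
  Literature.Computability.Cryptography Matrix

/-! ### Sums that only see finitely many variables -/

/-- A sum over `range k` of a function vanishing from `h` on and from `k` on is the sum over
`range h`. [folklore] -/
theorem sum_range_eq_of_vanish {M : Type*} [AddCommMonoid M] (g : ℕ → M) (k h : ℕ)
    (hk : ∀ j, k ≤ j → g j = 0) (hh : ∀ j, h ≤ j → g j = 0) :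
    ∑ j ∈ range k, g j = ∑ j ∈ range h, g j := by
  have e1 : ∑ j ∈ range k, g j = ∑ j ∈ range (k + h), g j :=
    Finset.sum_subset (Finset.range_subset_range.2 (Nat.le_add_right k h))
      (fun j _ hj => hk j (by simpa using hj))
  have e2 : ∑ j ∈ range h, g j = ∑ j ∈ range (k + h), g j :=
    Finset.sum_subset (Finset.range_subset_range.2 (Nat.le_add_left h k))
      (fun j _ hj => hh j (by simpa using hj))
  rw [e1, e2]

/-- `Σ_{p<n} (f(2p) + f(2p+1)) = Σ_{k<2n} f(k)`. [folklore] -/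
theorem sum_range_pairs {M : Type*} [AddCommMonoid M] (f : ℕ → M) (n : ℕ) :
    ∑ p ∈ range n, (f (2 * p) + f (2 * p + 1)) = ∑ k ∈ range (2 * n), f k := by
  induction n with
  | zero => simp
  | succ n ih =>
    rw [Finset.sum_range_succ, ih, show 2 * (n + 1) = 2 * n + 1 + 1 by ring, Finset.sum_range_succ,
      Finset.sum_range_succ, add_assoc]

namespace AffForm

/-- A form mentioning only variables `< h` has the same lift at two valuations (of possibly
different numbers of ambient variables) that agree below `h`. [folklore] -/
theorem lift_eq_of_agree {k k' h : ℕ} (f : AffForm) (hf : ∀ j, h ≤ j → f.coef j = false)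
    {w : Fin k → Bool} {w' : Fin k' → Bool} (hw : ∀ j, j < h → wbit w j = wbit w' j) :
    f.lift w = f.lift w' := by
  unfold lift
  congr 1
  rw [sum_range_eq_of_vanish _ k h (fun j hj => by rw [wbit_of_le w hj]; simp)
      (fun j hj => by rw [hf j hj]; simp),
    sum_range_eq_of_vanish _ k' h (fun j hj => by rw [wbit_of_le w' hj]; simp)
      (fun j hj => by rw [hf j hj]; simp)]
  exact Finset.sum_congr rfl fun j hj => by rw [hw j (Finset.mem_range.1 hj)]

/-- Same for the value. [folklore] -/
theorem eval_eq_of_agree {k k' h : ℕ} (f : AffForm) (hf : ∀ j, h ≤ j → f.coef j = false)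
    {w : Fin k → Bool} {w' : Fin k' → Bool} (hw : ∀ j, j < h → wbit w j = wbit w' j) :
    f.eval w = f.eval w' := by
  unfold eval; rw [f.lift_eq_of_agree hf hw]

end AffForm

namespace GData

/-- Data using only variables `< h` have the same value at two valuations that agree below `h`.
[folklore] -/
theorem val_eq_of_agree {k k' h : ℕ} (D : GData) (hD : ∀ p, h ≤ p → D.Unused p)
    {w : Fin k → Bool} {w' : Fin k' → Bool} (hw : ∀ j, j < h → wbit w j = wbit w' j) :
    D.val k w = D.val k' w' := by
  unfold val
  congr 2
  · unfold expI
    congr 1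
    rw [sum_range_eq_of_vanish _ k h (fun j hj => by rw [wbit_of_le w hj]; simp)
        (fun j hj => by rw [(hD j hj).1]; simp),
      sum_range_eq_of_vanish _ k' h (fun j hj => by rw [wbit_of_le w' hj]; simp)
        (fun j hj => by rw [(hD j hj).1]; simp)]
    exact Finset.sum_congr rfl fun j hj => by rw [hw j (Finset.mem_range.1 hj)]
  · unfold expNeg
    rw [sum_range_eq_of_vanish _ k h (fun l hl => by rw [wbit_of_le w hl]; simp)
        (fun l hl => Finset.sum_eq_zero fun j hj => by
          rw [(hD l hl).2.1 j (Finset.mem_range.1 hj)]; simp),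
      sum_range_eq_of_vanish _ k' h (fun l hl => by rw [wbit_of_le w' hl]; simp)
        (fun l hl => Finset.sum_eq_zero fun j hj => by
          rw [(hD l hl).2.1 j (Finset.mem_range.1 hj)]; simp)]
    refine Finset.sum_congr rfl fun l hl => Finset.sum_congr rfl fun j hj => ?_
    have hlh := Finset.mem_range.1 hl
    rw [hw l hlh, hw j (lt_trans (Finset.mem_range.1 hj) hlh)]

end GData

/-- Bits of an appended valuation. [folklore] -/
theorem wbit_append {h m : ℕ} (u : Fin h → Bool) (s : Fin m → Bool) (j : ℕ) :
    wbit (Fin.append u s) j = if j < h then wbit u j else wbit s (j - h) := by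
  by_cases hj : j < h
  · rw [if_pos hj, wbit_of_lt _ (by omega), wbit_of_lt u hj]
    exact Fin.append_left u s ⟨j, hj⟩
  · rw [if_neg hj]
    by_cases hj' : j < h + m
    · rw [wbit_of_lt _ hj', wbit_of_lt s (by omega)]
      have : (⟨j, hj'⟩ : Fin (h + m)) = Fin.natAdd h ⟨j - h, by omega⟩ := Fin.ext (by simp; omega)
      rw [this]
      exact Fin.append_right u s _
    · rw [wbit_of_le _ (Nat.not_lt.1 hj'), wbit_of_le s (by omega)]

namespace SymState

/-- Under `Supp`, the label only sees the variables below the counter. [folklore] -/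
theorem Supp.label_eq_of_agree {k k' N : ℕ} {σ : SymState} (hσ : σ.Supp) {w : Fin k → Bool}
    {w' : Fin k' → Bool} (hw : ∀ j, j < σ.nv → wbit w j = wbit w' j) : σ.label N w = σ.label N w' :=
  funext fun j => AffForm.eval_eq_of_agree _ (fun p hp => (hσ p hp).1 j) hw

/-- Under `Supp`, the `T`-count only sees the variables below the counter. [folklore] -/
theorem Supp.tcount_eq_of_agree {k k' : ℕ} {σ : SymState} (hσ : σ.Supp) {w : Fin k → Bool}
    {w' : Fin k' → Bool} (hw : ∀ j, j < σ.nv → wbit w j = wbit w' j) : σ.tcount w = σ.tcount w' := by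
  unfold tcount
  congr 1
  exact List.map_congr_left fun f hf => by
    rw [AffForm.eval_eq_of_agree f (fun p hp => (hσ p hp).2.1 f hf) hw]

/-- Under `Supp`, the phase only sees the variables below the counter. [folklore] -/
theorem Supp.phase_eq_of_agree {k k' : ℕ} {σ : SymState} (hσ : σ.Supp) {w : Fin k → Bool}
    {w' : Fin k' → Bool} (hw : ∀ j, j < σ.nv → wbit w j = wbit w' j) : σ.phase k w = σ.phase k' w' := by
  unfold phase
  rw [GData.val_eq_of_agree σ.D (fun p hp => (hσ p hp).2.2) hw, hσ.tcount_eq_of_agree hw]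

/-- The `T`-forms, indexed by naturals (the constant `0` beyond the list: an odd number of `T`
gates is completed to pairs by a phantom `T` gate on a wire carrying `0`). [folklore] -/
def tform (σ : SymState) (k : ℕ) : AffForm := σ.tforms.getD k (AffForm.const false)

/-- The `T`-count as a sum over indices, over any range covering the list. [folklore] -/
theorem tcount_eq_sum {V : ℕ} (σ : SymState) (w : Fin V → Bool) (n : ℕ) (hn : σ.tforms.length ≤ n) :
    σ.tcount w = ∑ k ∈ range n, Bool.toNat ((σ.tform k).eval w) := by
  unfold tcount tform
  rw [sum_range_eq_of_vanish _ n σ.tforms.length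
    (fun k hk => by rw [List.getD_eq_default _ _ (le_trans hn hk), AffForm.eval_const]; rfl)
    (fun k hk => by rw [List.getD_eq_default _ _ hk, AffForm.eval_const]; rfl)]
  induction σ.tforms with
  | nil => simp
  | cons f l ih =>
    rw [List.map_cons, List.sum_cons, List.length_cons, Finset.sum_range_succ', ih]
    simp only [List.getD_cons_succ, List.getD_cons_zero]
    rw [add_comm]

/-- Under `Supp`, the `T`-forms mention no variable `≥ nv`. [folklore] -/
theorem Supp.coef_tform {σ : SymState} (hσ : σ.Supp) (k p : ℕ) (hp : σ.nv ≤ p) :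
    (σ.tform k).coef p = false := by
  unfold tform
  by_cases hk : k < σ.tforms.length
  · rw [List.getD_eq_getElem _ _ hk]
    exact (hσ p hp).2.1 _ (List.getElem_mem hk)
  · rw [List.getD_eq_default _ _ (Nat.not_lt.1 hk), AffForm.coef_const]

end SymState

/-! ### The test phase read off a bit string -/

/-- Position of the bit `R_{jj'}` (`j < j'`) in the sample block: entry `(j', j)` of an `N × N`
square of bits, row-major (the bits on and above the diagonal, `j ≥ j'`, are not used — a layout
chosen so that positions decode by division with remainder). [folklore] -/
def idxR (N j j' : ℕ) : ℕ := j' * N + j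

/-- Position of the low bit of `ρ_j`. [folklore] -/
def idxRho0 (N j : ℕ) : ℕ := N * N + 2 * j

/-- Position of the high bit of `ρ_j`. [folklore] -/
def idxRho1 (N j : ℕ) : ℕ := N * N + 2 * j + 1

/-- The number of bits of one sample block: `N² + 2N`. [folklore] -/
def blockLen (N : ℕ) : ℕ := N * N + 2 * N

/-- `ρ_j ∈ {0, 1, 2, 3}` read off the block. [folklore] -/
def rhoAt (N : ℕ) (β : ℕ → Bool) (j : ℕ) : ℕ := Bool.toNat (β (idxRho0 N j)) + 2 * Bool.toNat (β (idxRho1 N j))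

/-- The conjugate exponent `κ_j = −ρ_j mod 4`. [folklore] -/
def kapAt (N : ℕ) (β : ℕ → Bool) (j : ℕ) : ℕ := (4 - rhoAt N β j) % 4

/-- `ρ_j ≤ 3`. [folklore] -/
theorem rhoAt_le (N : ℕ) (β : ℕ → Bool) (j : ℕ) : rhoAt N β j ≤ 3 := by
  unfold rhoAt
  cases β (idxRho0 N j) <;> cases β (idxRho1 N j) <;> simp

/-- `κ_j + ρ_j ≡ 0 (mod 4)`. [folklore] -/
theorem kapAt_add_rhoAt (N : ℕ) (β : ℕ → Bool) (j : ℕ) : (kapAt N β j + rhoAt N β j) % 4 = 0 := by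
  unfold kapAt
  have := rhoAt_le N β j
  omega

/-- The exponent of `−1` in the test phase: `z·Rz = Σ_{j<j'<N} R_{jj'} z_j z_{j'}`. [folklore] -/
def quadR {n : ℕ} (N : ℕ) (β : ℕ → Bool) (z : Fin n → Bool) : ℕ :=
  ∑ j' ∈ range N, ∑ j ∈ range j', Bool.toNat (β (idxR N j j') && wbit z j && wbit z j')

/-- The exponent of `i` in the conjugate test phase: `Σ_j κ_j z_j`. [folklore] -/
def linKap {n : ℕ} (N : ℕ) (β : ℕ → Bool) (z : Fin n → Bool) : ℕ :=
  ∑ j ∈ range N, kapAt N β j * Bool.toNat (wbit z j)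

/-- **The conjugate test phase** `θ̄_β(z) · 2^{N/2} = (−1)^{z·Rz} i^{−ρ·z}` of the equatorial state
`θ_β = 2^{-N/2} Σ_z (−1)^{z·Rz} i^{ρ·z} |z⟩` (written for labels with any number `n` of entries,
read through `wbit`; used with `n = N`). [cite: BravyiEtAl2019, §4.1 (equatorial states)] -/
def ccPhase {n : ℕ} (N : ℕ) (β : ℕ → Bool) (z : Fin n → Bool) : ℂ :=
  (-1 : ℂ) ^ quadR N β z * I ^ linKap N β z

/-! ### Augmenting the Clifford data by the test phase -/

namespace SymState

/-- Add the quadratic part `(−1)^{Σ_{j<j'} R_{jj'} o_j o_{j'}}` of the test phase, one pair of wires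
at a time (inner loop over `j < j'`). [folklore] -/
def augR (N : ℕ) (β : ℕ → Bool) (σ : SymState) (D : GData) : GData :=
  (List.range N).foldl (fun D j' => (List.range j').foldl
    (fun D j => if β (idxR N j j') then GData.addQuadProduct (σ.form j) (σ.form j') D else D) D) D

/-- Add the linear part `i^{Σ_j κ_j o_j}` of the conjugate test phase. [folklore] -/
def augRho (N : ℕ) (β : ℕ → Bool) (σ : SymState) (D : GData) : GData :=
  (List.range N).foldl (fun D j => GData.addPhaseForm (kapAt N β j) (σ.form j) D) D

/-- The Clifford data multiplied by the conjugate test phase at the output label. [folklore] -/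
def augTheta (N : ℕ) (β : ℕ → Bool) (σ : SymState) : GData := augRho N β σ (augR N β σ σ.D)

/-- Value of the inner `R`-loop. [folklore] -/
theorem val_augR_inner {V : ℕ} (N : ℕ) (β : ℕ → Bool) (σ : SymState) (j' : ℕ) (D : GData) (w : Fin V → Bool) (n : ℕ) :
    ((List.range n).foldl
      (fun D j => if β (idxR N j j') then GData.addQuadProduct (σ.form j) (σ.form j') D else D) D).val V w =
      D.val V w * (-1 : ℂ) ^ ∑ j ∈ range n,
        Bool.toNat (β (idxR N j j') && (σ.form j).eval w && (σ.form j').eval w) := by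
  induction n with
  | zero => simp
  | succ n ih =>
    rw [List.range_succ, List.foldl_append, List.foldl_cons, List.foldl_nil, Finset.sum_range_succ,
      pow_add, ← mul_assoc, ← ih]
    by_cases hb : β (idxR N n j') = true
    · rw [if_pos hb, GData.val_addQuadProduct, hb, Bool.true_and]
    · rw [if_neg hb, Bool.eq_false_iff.2 hb]
      simp

/-- The quadratic exponent at a label is the double sum over the wire forms. [folklore] -/
theorem quadR_label {V : ℕ} (N : ℕ) (β : ℕ → Bool) (σ : SymState) (w : Fin V → Bool) :
    quadR N β (σ.label N w) = ∑ j' ∈ range N, ∑ j ∈ range j',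
      Bool.toNat (β (idxR N j j') && (σ.form j).eval w && (σ.form j').eval w) := by
  unfold quadR
  refine Finset.sum_congr rfl fun j' hj' => Finset.sum_congr rfl fun j hj => ?_
  have hj'N := Finset.mem_range.1 hj'
  have hjN : j < N := lt_trans (Finset.mem_range.1 hj) hj'N
  rw [wbit_of_lt _ hjN, wbit_of_lt _ hj'N]
  rfl

/-- The linear exponent at a label is the sum over the wire forms. [folklore] -/
theorem linKap_label {V : ℕ} (N : ℕ) (β : ℕ → Bool) (σ : SymState) (w : Fin V → Bool) :
    linKap N β (σ.label N w) = ∑ j ∈ range N, kapAt N β j * Bool.toNat ((σ.form j).eval w) := by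
  unfold linKap
  refine Finset.sum_congr rfl fun j hj => ?_
  rw [wbit_of_lt _ (Finset.mem_range.1 hj)]
  rfl

/-- Value of `augR`: the quadratic part of the test phase at the wire forms. [folklore] -/
theorem val_augR {V : ℕ} (N : ℕ) (β : ℕ → Bool) (σ : SymState) (D : GData) (w : Fin V → Bool) :
    (augR N β σ D).val V w = D.val V w * (-1 : ℂ) ^ quadR N β (σ.label N w) := by
  rw [quadR_label]
  unfold augR
  suffices key : ∀ n, ((List.range n).foldl (fun D j' => (List.range j').foldl
      (fun D j => if β (idxR N j j') then GData.addQuadProduct (σ.form j) (σ.form j') D else D) D) D).val V w =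
      D.val V w * (-1 : ℂ) ^ ∑ j' ∈ range n, ∑ j ∈ range j',
        Bool.toNat (β (idxR N j j') && (σ.form j).eval w && (σ.form j').eval w) from key N
  intro n
  induction n with
  | zero => simp
  | succ n ih =>
    rw [List.range_succ, List.foldl_append, List.foldl_cons, List.foldl_nil, val_augR_inner, ih,
      Finset.sum_range_succ, pow_add, mul_assoc]

/-- Value of `augRho`: the linear part of the conjugate test phase at the wire forms. [folklore] -/
theorem val_augRho {V : ℕ} (N : ℕ) (β : ℕ → Bool) (σ : SymState) (D : GData) (w : Fin V → Bool) :
    (augRho N β σ D).val V w = D.val V w * I ^ linKap N β (σ.label N w) := by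
  rw [linKap_label]
  unfold augRho
  suffices key : ∀ n, ((List.range n).foldl (fun D j => GData.addPhaseForm (kapAt N β j) (σ.form j) D) D).val V w =
      D.val V w * I ^ ∑ j ∈ range n, kapAt N β j * Bool.toNat ((σ.form j).eval w) from key N
  intro n
  induction n with
  | zero => simp
  | succ n ih =>
    rw [List.range_succ, List.foldl_append, List.foldl_cons, List.foldl_nil, GData.val_addPhaseForm,
      ih, Finset.sum_range_succ, pow_add, mul_assoc, ← pow_mul, mul_comm (Bool.toNat _)]

/-- **Value of `augTheta`**: the Clifford phase times the conjugate test phase at the output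
label. [cite: BravyiEtAl2019, §4.1] -/
theorem val_augTheta {V : ℕ} (N : ℕ) (β : ℕ → Bool) (σ : SymState) (w : Fin V → Bool) :
    (augTheta N β σ).val V w = σ.D.val V w * ccPhase N β (σ.label N w) := by
  unfold augTheta ccPhase
  rw [val_augRho, val_augR, mul_assoc]

/-! ### The output constraint and the pair constraints -/

/-- The number of `a`-bits: `⌈t/2⌉` pairs of `T` gates (an odd `t` is completed by a phantom `T`
gate on a constant-`0` wire). [cite: BravyiGosset2016, eq. (17) and §II] -/
def numA (σ : SymState) : ℕ := (σ.tforms.length + 1) / 2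

/-- Add the output constraint `[o_0(w) = 1] = ½ Σ_{s} (−1)^{s (o_0(w) ⊕ 1)}` on the fresh variable
`s = w_h`. [folklore] -/
def augOut (h : ℕ) (σ : SymState) (D : GData) : GData :=
  GData.addQuadProduct (AffForm.unit h) ((σ.form 0).addConst true) D

/-- Value of `augOut`. [folklore] -/
theorem val_augOut {V : ℕ} (h : ℕ) (hh : h < V) (σ : SymState) (D : GData) (w : Fin V → Bool) :
    (augOut h σ D).val V w =
      D.val V w * (-1 : ℂ) ^ Bool.toNat (w ⟨h, hh⟩ && !((σ.form 0).eval w)) := by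
  unfold augOut
  rw [GData.val_addQuadProduct, AffForm.eval_unit h hh, AffForm.eval_addConst, Bool.xor_true]

/-- The factor of pair `p` with bit `b`: the constraint sign `(−1)^{s_p (u ⊕ u' ⊕ b)}` on the fresh
variable `s_p = w_{h+1+p}` and, for `b = 0`, the phase `i^{u}`.
[cite: BravyiGosset2016, eq. (17)] -/
def pairStep (h : ℕ) (σ : SymState) (a : ℕ → Bool) (D : GData) (p : ℕ) : GData :=
  let u := σ.tform (2 * p)
  let u' := σ.tform (2 * p + 1)
  let D₁ := GData.addQuadProduct (AffForm.unit (h + 1 + p)) ((u.add u').addConst (a p)) D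
  if a p then D₁ else GData.addPhaseForm 1 u D₁

/-- Add all pair factors. [cite: BravyiGosset2016, eq. (17)] -/
def augA (h : ℕ) (σ : SymState) (a : ℕ → Bool) (D : GData) : GData :=
  (List.range (numA σ)).foldl (pairStep h σ a) D

/-- The complex factor of pair `p` with bit `b` at the valuation `w` (fresh bit `s`):
`(−1)^{s · [u ⊕ u' ⊕ b]} · (i^{[u]})^{[¬ b]}`. [cite: BravyiGosset2016, eq. (17)] -/
def pairFactor (u u' b s : Bool) : ℂ :=
  (-1 : ℂ) ^ Bool.toNat (s && ((u ^^ u') ^^ b)) * (I ^ Bool.toNat u) ^ Bool.toNat (!b)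

/-- Value of one `pairStep`. [folklore] -/
theorem val_pairStep {V : ℕ} (h : ℕ) (σ : SymState) (a : ℕ → Bool) (D : GData) (p : ℕ)
    (hp : h + 1 + p < V) (w : Fin V → Bool) :
    (pairStep h σ a D p).val V w = D.val V w *
      pairFactor ((σ.tform (2 * p)).eval w) ((σ.tform (2 * p + 1)).eval w) (a p) (w ⟨h + 1 + p, hp⟩) := by
  unfold pairStep pairFactor
  simp only
  cases hap : a p
  · simp only [Bool.false_eq_true, if_false]
    rw [GData.val_addPhaseForm, GData.val_addQuadProduct, AffForm.eval_unit _ hp, AffForm.eval_addConst,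
      AffForm.eval_add, pow_one]
    simp [mul_assoc]
  · simp only [if_true]
    rw [GData.val_addQuadProduct, AffForm.eval_unit _ hp, AffForm.eval_addConst, AffForm.eval_add]
    simp

/-- **Value of `augA`**: the product of the pair factors. [folklore] -/
theorem val_augA {V : ℕ} (h : ℕ) (σ : SymState) (a : ℕ → Bool) (D : GData) (hV : h + 1 + numA σ ≤ V)
    (w : Fin V → Bool) :
    (augA h σ a D).val V w = D.val V w * ∏ p ∈ range (numA σ),
      pairFactor ((σ.tform (2 * p)).eval w) ((σ.tform (2 * p + 1)).eval w) (a p) (wbit w (h + 1 + p)) := by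
  unfold augA
  suffices key : ∀ n, n ≤ numA σ → ((List.range n).foldl (pairStep h σ a) D).val V w =
      D.val V w * ∏ p ∈ range n,
        pairFactor ((σ.tform (2 * p)).eval w) ((σ.tform (2 * p + 1)).eval w) (a p) (wbit w (h + 1 + p)) from
    key _ le_rfl
  intro n hn
  induction n with
  | zero => simp
  | succ n ih =>
    have hp : h + 1 + n < V := by omega
    rw [List.range_succ, List.foldl_append, List.foldl_cons, List.foldl_nil, val_pairStep h σ a _ n hp,
      ih (Nat.le_of_succ_le hn), Finset.prod_range_succ, mul_assoc, wbit_of_lt w hp]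

/-- **The Gauss data of the `a`-th term against the test state `β`**, over
`V = h + 1 + ⌈t/2⌉` variables. [cite: BravyiGosset2016, §II eq. (12)–(13) and eq. (17)] -/
def buildData (N h : ℕ) (β : ℕ → Bool) (a : ℕ → Bool) (σ : SymState) : GData :=
  augA h σ a (augOut h σ (augTheta N β σ))

/-- The number of variables of `buildData`. [folklore] -/
def numV (h : ℕ) (σ : SymState) : ℕ := h + (numA σ + 1)

/-- **Value of `buildData`** at `w` (any number `V ≥ h + 1 + ⌈t/2⌉` of ambient variables):
Clifford phase, conjugate test phase at the label, output sign, and the pair factors. [folklore] -/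
theorem val_buildData {V : ℕ} (N h : ℕ) (β : ℕ → Bool) (a : ℕ → Bool) (σ : SymState)
    (hV : h + 1 + numA σ ≤ V) (w : Fin V → Bool) :
    (buildData N h β a σ).val V w =
      σ.D.val V w * ccPhase N β (σ.label N w) *
        (-1 : ℂ) ^ Bool.toNat (wbit w h && !((σ.form 0).eval w)) *
        ∏ p ∈ range (numA σ),
          pairFactor ((σ.tform (2 * p)).eval w) ((σ.tform (2 * p + 1)).eval w) (a p) (wbit w (h + 1 + p)) := by
  have hh : h < V := by omega
  unfold buildData
  rw [val_augA h σ a _ hV, val_augOut h hh, val_augTheta, wbit_of_lt w hh]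

/-- The `T`-count in pairs: `Σ_{p < ⌈t/2⌉} ([u_{2p}] + [u_{2p+1}])`. [folklore] -/
theorem tcount_eq_sum_pairs {V : ℕ} (σ : SymState) (w : Fin V → Bool) :
    σ.tcount w = ∑ p ∈ range (numA σ),
      (Bool.toNat ((σ.tform (2 * p)).eval w) + Bool.toNat ((σ.tform (2 * p + 1)).eval w)) := by
  rw [sum_range_pairs (fun k => Bool.toNat ((σ.tform k).eval w)) (numA σ)]
  exact σ.tcount_eq_sum w _ (by unfold numA; omega)

end SymState

/-! ### Summing out independent bits -/

/-- **Sums of products of one-bit factors factor**: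
`Σ_{s ∈ 𝔽₂^m} Π_{q<m} G_q(s_q) = Π_{q<m} (G_q(0) + G_q(1))`. [folklore] -/
theorem sum_prod_wbit (m : ℕ) (G : ℕ → Bool → ℂ) :
    ∑ s : Fin m → Bool, ∏ q ∈ range m, G q (wbit s q) = ∏ q ∈ range m, (G q false + G q true) := by
  induction m with
  | zero => simp
  | succ m ih =>
    rw [sum_snoc, Finset.prod_range_succ, ← ih, Finset.sum_mul]
    refine Finset.sum_congr rfl fun s _ => ?_
    have hsplit : ∀ c : Bool, ∏ q ∈ range (m + 1), G q (wbit (Fin.snoc s c : Fin (m + 1) → Bool) q) =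
        (∏ q ∈ range m, G q (wbit s q)) * G m c := by
      intro c
      rw [Finset.prod_range_succ, wbit_snoc, if_pos rfl]
      congr 1
      exact Finset.prod_congr rfl fun q hq => by rw [wbit_snoc, if_neg (Nat.ne_of_lt (Finset.mem_range.1 hq))]
    rw [hsplit, hsplit, mul_add]

/-! ### The pair identity -/

/-- The weight of pair bit `b` at `T`-values `x, y`: `[x ⊕ y = b] · (i^{[x]})^{[¬ b]}`.
[cite: BravyiGosset2016, eq. (17)] -/
def pairChi (x y b : Bool) : ℂ := if (x ^^ y) = b then (I ^ Bool.toNat x) ^ Bool.toNat (!b) else 0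

/-- **Bravyi–Gosset's pair identity** `ω^{x+y} = [x = y] i^{x} + ω [x ≠ y]` (the phase form of the
two-stabilizer decomposition `|A⟩^{⊗2} = ½(|00⟩ + i|11⟩) + (ω/√2)·(|01⟩+|10⟩)/√2`, eq. (17)).
[cite: BravyiGosset2016, eq. (17)] -/
theorem omega_pow_pair (x y : Bool) :
    pairChi x y false + omega * pairChi x y true = omega ^ (Bool.toNat x + Bool.toNat y) := by
  unfold pairChi
  cases x <;> cases y <;> simp [omega_pow_two]

/-- Summing the constraint bit of a pair factor gives twice the pair weight. [folklore] -/
theorem pairFactor_false_add_true (x y b : Bool) :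
    SymState.pairFactor x y b false + SymState.pairFactor x y b true = 2 * pairChi x y b := by
  unfold SymState.pairFactor pairChi
  cases x <;> cases y <;> cases b <;> simp <;> ring

/-! ### The key identity -/

namespace SymState

/-- Overriding all variables of a valuation by `v` gives `v`. [folklore] -/
theorem ovr_self {h : ℕ} (w v : Fin h → Bool) : ovr w 0 v = v := by
  funext j
  unfold ovr
  rw [dif_pos ⟨Nat.zero_le _, by simp⟩]
  congr 1

/-- **The Gauss sum of one term**, summed over its `1 + ⌈t/2⌉` constraint variables: for a final
symbolic state `σ` (`Supp`, counter `h`) and any `a`,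
`Γ(a, β) = 2^{1+⌈t/2⌉} Σ_{u ∈ 𝔽₂^h} [o₀(u) = 1] · val(u) · θ̄-phase(label u) · Π_p χ_p(a_p, u)`.
[cite: BravyiGosset2016, §II eq. (12)–(13)] -/
theorem gsum_buildData {N : ℕ} (β : ℕ → Bool) (a : ℕ → Bool) (σ : SymState) (hσ : σ.Supp) :
    GData.gsum (numV σ.nv σ) (buildData N σ.nv β a σ) =
      2 ^ (numA σ + 1) * ∑ u : Fin σ.nv → Bool,
        if (σ.form 0).eval u then
          σ.D.val σ.nv u * ccPhase N β (σ.label N u) *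
            ∏ p ∈ range (numA σ), pairChi ((σ.tform (2 * p)).eval u) ((σ.tform (2 * p + 1)).eval u) (a p)
        else 0 := by
  set h := σ.nv with hh
  set n := numA σ with hn
  unfold GData.gsum
  show ∑ w : Fin (h + (n + 1)) → Bool, (buildData N h β a σ).val (h + (n + 1)) w = _
  rw [← (Fin.appendEquiv h (n + 1)).sum_comp, Fintype.sum_prod_type, Finset.mul_sum]
  refine Finset.sum_congr rfl fun u _ => ?_
  have happ : ∀ s : Fin (n + 1) → Bool, (Fin.appendEquiv h (n + 1)) (u, s) = Fin.append u s := fun _ => rfl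
  simp only [happ]
  -- everything about `σ` at `append u s` is about `u`
  have hagree : ∀ (s : Fin (n + 1) → Bool) (j : ℕ), j < h → wbit (Fin.append u s) j = wbit u j := by
    intro s j hj; rw [wbit_append, if_pos hj]
  have hform : ∀ (s : Fin (n + 1) → Bool) (j : ℕ), (σ.form j).eval (Fin.append u s) = (σ.form j).eval u :=
    fun s j => AffForm.eval_eq_of_agree _ (fun p hp => (hσ p hp).1 j) (hagree s)
  have htform : ∀ (s : Fin (n + 1) → Bool) (k : ℕ), (σ.tform k).eval (Fin.append u s) = (σ.tform k).eval u :=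
    fun s k => AffForm.eval_eq_of_agree _ (fun p hp => hσ.coef_tform k p hp) (hagree s)
  have hval : ∀ s : Fin (n + 1) → Bool, σ.D.val (h + (n + 1)) (Fin.append u s) = σ.D.val h u :=
    fun s => GData.val_eq_of_agree σ.D (fun p hp => (hσ p hp).2.2) (hagree s)
  have hlab : ∀ s : Fin (n + 1) → Bool, σ.label N (Fin.append u s) = σ.label N u :=
    fun s => hσ.label_eq_of_agree (hagree s)
  have hbit0 : ∀ s : Fin (n + 1) → Bool, wbit (Fin.append u s) h = wbit s 0 := by
    intro s; rw [wbit_append, if_neg (lt_irrefl _), Nat.sub_self]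
  have hbitp : ∀ (s : Fin (n + 1) → Bool) (p : ℕ), wbit (Fin.append u s) (h + 1 + p) = wbit s (p + 1) := by
    intro s p; rw [wbit_append, if_neg (by omega)]; congr 1; omega
  -- the summand as a product of one-bit factors
  set C : ℂ := σ.D.val h u * ccPhase N β (σ.label N u) with hC
  set G : ℕ → Bool → ℂ := fun q b => match q with
    | 0 => (-1 : ℂ) ^ Bool.toNat (b && !((σ.form 0).eval u))
    | p + 1 => pairFactor ((σ.tform (2 * p)).eval u) ((σ.tform (2 * p + 1)).eval u) (a p) b with hG
  have hsummand : ∀ s : Fin (n + 1) → Bool,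
      (buildData N h β a σ).val (h + (n + 1)) (Fin.append u s) = C * ∏ q ∈ range (n + 1), G q (wbit s q) := by
    intro s
    rw [val_buildData N h β a σ (by omega), Finset.prod_range_succ', hC]
    simp only [hG]
    rw [hval, hlab, hbit0, hform]
    simp only [htform, hbitp]
    ring
  rw [Finset.sum_congr rfl fun s _ => hsummand s, ← Finset.mul_sum, sum_prod_wbit,
    Finset.prod_range_succ']
  simp only [hG, pairFactor_false_add_true, Bool.false_and, Bool.toNat_false, pow_zero, Bool.true_and]
  rw [Finset.prod_mul_distrib, Finset.prod_const, Finset.card_range]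
  cases (σ.form 0).eval u
  · simp
  · simp only [Bool.not_true, Bool.toNat_false, pow_zero, if_true]
    ring

/-- **The key identity.** Summing the `2^{⌈t/2⌉}` terms with Bravyi–Gosset's weights `ω^{|a|}`
recombines the `T`-phases:
`Σ_a ω^{|a|} Γ(a, β) = 2^{1+⌈t/2⌉} Σ_{u ∈ 𝔽₂^h} [o₀(u) = 1] · θ̄-phase(label u) · phase(u)`.
[cite: BravyiGosset2016, §II eq. (12)–(13) and eq. (17)] -/
theorem sum_omega_pow_mul_gsum_buildData {N : ℕ} (β : ℕ → Bool) (σ : SymState) (hσ : σ.Supp) :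
    ∑ a : Fin (numA σ) → Bool, omega ^ (∑ p ∈ range (numA σ), Bool.toNat (wbit a p)) *
        GData.gsum (numV σ.nv σ) (buildData N σ.nv β (wbit a) σ) =
      2 ^ (numA σ + 1) * ∑ u : Fin σ.nv → Bool,
        if (σ.form 0).eval u then ccPhase N β (σ.label N u) * σ.phase σ.nv u else 0 := by
  simp only [gsum_buildData β _ σ hσ, Finset.mul_sum]
  -- reorder: `Σ_a ω^{|a|} (2^{n+1} Σ_u F a u) = 2^{n+1} Σ_u Σ_a ω^{|a|} F a u`
  rw [Finset.sum_comm]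
  refine Finset.sum_congr rfl fun u _ => ?_
  cases (σ.form 0).eval u
  · simp
  · simp only [if_true]
    have hre : ∀ a : Fin (numA σ) → Bool,
        omega ^ (∑ p ∈ range (numA σ), Bool.toNat (wbit a p)) *
          (2 ^ (numA σ + 1) * (σ.D.val σ.nv u * ccPhase N β (σ.label N u) *
            ∏ p ∈ range (numA σ), pairChi ((σ.tform (2 * p)).eval u) ((σ.tform (2 * p + 1)).eval u) (wbit a p))) =
        2 ^ (numA σ + 1) * (σ.D.val σ.nv u * ccPhase N β (σ.label N u)) *
          ∏ p ∈ range (numA σ), (omega ^ Bool.toNat (wbit a p) *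
            pairChi ((σ.tform (2 * p)).eval u) ((σ.tform (2 * p + 1)).eval u) (wbit a p)) := by
      intro a
      rw [Finset.prod_mul_distrib, Finset.prod_pow_eq_pow_sum]
      ring
    simp only [hre]
    rw [← Finset.mul_sum, sum_prod_wbit (numA σ) (fun p b => omega ^ Bool.toNat b *
      pairChi ((σ.tform (2 * p)).eval u) ((σ.tform (2 * p + 1)).eval u) b)]
    simp only [Bool.toNat_false, pow_zero, one_mul, Bool.toNat_true, pow_one, omega_pow_pair,
      Finset.prod_pow_eq_pow_sum]
    unfold phase
    rw [σ.tcount_eq_sum_pairs u]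
    ring

/-- **The key identity against amplitudes.** For an oracle-free gate list `gs` with `h` Hadamard
gates on `N ≥ 1` wires, its final symbolic state `σ = symExec gs (init y)`, and any sample bits
`β`: `(1/√2)^h Σ_a ω^{|a|} Γ(a, β) = 2^{1+⌈t/2⌉} Σ_{z : z₀ = 1} θ̄_β-phase(z) · ⟨z| U_{gs} |y⟩`.
[cite: BravyiGosset2016, §II] -/
theorem sum_omega_pow_mul_gsum_buildData_eq_amplitudes {N : ℕ} (hN : 0 < N)
    (gs : List (QGate cliffordT N)) (hgs : ∀ g ∈ gs, g.IsOracleFree) (y : QReg N) (β : ℕ → Bool) :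
    let σ := execGates gs (init y)
    invSqrt2 ^ hCount gs * ∑ a : Fin (numA σ) → Bool,
        omega ^ (∑ p ∈ range (numA σ), Bool.toNat (wbit a p)) *
          GData.gsum (numV σ.nv σ) (buildData N σ.nv β (wbit a) σ) =
      2 ^ (numA σ + 1) * ∑ z : QReg N,
        if z ⟨0, hN⟩ then ccPhase N β z * (prodZeta omega gs *ᵥ basisState y) z else 0 := by
  intro σ
  have hσ : σ.Supp := (supp_init y).exec _
  have hnv : σ.nv = hCount gs := by
    show (exec (gs.map toSymGate) (init y)).nv = hCount gs
    suffices key : ∀ (l : List (QGate cliffordT N)) (τ : SymState), (exec (l.map toSymGate) τ).nv = τ.nv + hCount l by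
      rw [key]; show 0 + hCount gs = hCount gs; rw [Nat.zero_add]
    intro l
    induction l with
    | nil => intro τ; simp
    | cons g l ih =>
      intro τ
      rw [List.map_cons, exec_cons, ih, nv_step, hCount_cons]
      cases g with
      | oracle k e => simp [toSymGate, QGateIsH]
      | gate op e => cases op <;> simp [toSymGate, QGateIsH]; omega
  -- amplitudes as sums over paths, grouped by label
  have hamp : ∀ z : QReg N, (prodZeta omega gs *ᵥ basisState y) z =
      invSqrt2 ^ hCount gs * ∑ u : Fin σ.nv → Bool, if σ.label N u = z then σ.phase σ.nv u else 0 := by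
    intro z
    rw [prodZeta_apply_eq_sum gs hgs (le_of_eq hnv.symm) y z (fun _ => false)]
    rw [hnv]
    congr 1
    refine Fintype.sum_equiv (Equiv.refl _) _ _ fun v => ?_
    rw [Equiv.refl_apply, show execGates gs (init y) = σ from rfl, ovr_self]
  have hinner : invSqrt2 ^ hCount gs * ∑ u : Fin σ.nv → Bool,
      (if (σ.form 0).eval u then ccPhase N β (σ.label N u) * σ.phase σ.nv u else 0) =
      ∑ z : QReg N, if z ⟨0, hN⟩ then ccPhase N β z * (prodZeta omega gs *ᵥ basisState y) z else 0 := by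
    have hexp : ∀ z : QReg N,
        (if z ⟨0, hN⟩ = true then ccPhase N β z * (prodZeta omega gs *ᵥ basisState y) z else 0) =
        ∑ u : Fin σ.nv → Bool, if σ.label N u = z then
          invSqrt2 ^ hCount gs * (if z ⟨0, hN⟩ = true then ccPhase N β z * σ.phase σ.nv u else 0) else 0 := by
      intro z
      rw [hamp z]
      cases z ⟨0, hN⟩
      · simp
      · simp only [if_true, Finset.mul_sum]
        refine Finset.sum_congr rfl fun u _ => ?_
        split <;> ring
    rw [Finset.sum_congr rfl fun z _ => hexp z, Finset.sum_comm, Finset.mul_sum]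
    refine Finset.sum_congr rfl fun u _ => ?_
    rw [Finset.sum_ite_eq]
    simp only [Finset.mem_univ, if_true]
    rfl
  rw [sum_omega_pow_mul_gsum_buildData β σ hσ, mul_left_comm, hinner]

end SymState

end Literature.Computability.QuantumComplexity.BravyiGosset

end
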